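import Summits.HubbardSuperconductivity.HubbardSuperconductivity.Theorems.BalabanIRBirBdGPhaseCoercivityStencils

/-!
# Route BalabanIR — crux 3 `BirBdGPhaseCoercivity` (item `stmt-HubbardSuperconductivity-2081`):
# IV. Symbols of the hopping and pairing stencils; the full gap

For `L ≥ 3` the Fourier symbols of the stencils of file III are the band function
`ξ_k = -2cos p₀ - 2cos p₁ - μ` and the `d+id` gap function
`Δ_k = 2Δ₁(cos p₀ - cos p₁) - 4iΔ₂ sin p₀ sin p₁`, `p = 2πk/L` (`torusFourier_hopVec`,
`torusFourier_pairVec`); and `ξ_k² + |Δ_k|² > 0` whenever `μ ∈ (-4,4)` and `Δ₁Δ₂ ≠ 0`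
(`bdg_dispersion_pos`: `Δ_k = 0` forces `sin p₀ sin p₁ = 0` and `cos p₀ = cos p₁ = ±1`, where
`ξ_k = ∓4 - μ ≠ 0`).

References: the crux docstring (`Theses/BalabanIR.lean`, `BirBdGPhaseCoercivity`). No definition
is introduced.
-/

noncomputable section

namespace Summit.HubbardSuperconductivity.HubbardSuperconductivity.Theorems

namespace BirBdG

open Matrix Finset Literature.Probability.LatticeModels
open scoped ComplexConjugate

variable {L : ℕ} [NeZero L]

/-! ### Distinctness of the stencil vectors (`L ≥ 3`) -/

omit [NeZero L] in
/-- `-eᵢ ≠ eᵢ` in `(ℤ/L)²` for `L ≥ 3`. [folklore] -/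
theorem neg_single_ne_single (hL : 3 ≤ L) (i : Fin 2) :
    -(Pi.single i 1 : TorusSite 2 L) ≠ Pi.single i 1 := by
  intro h
  have := congrFun h i
  simp only [Pi.neg_apply, Pi.single_eq_same] at this
  exact one_ne_neg_one_zmod hL this.symm

omit [NeZero L] in
/-- `-(e₀ + e₁) ≠ e₀ + e₁` in `(ℤ/L)²` for `L ≥ 3`. [folklore] -/
theorem neg_diag_ne_diag (hL : 3 ≤ L) :
    -(Pi.single 0 1 + Pi.single 1 1 : TorusSite 2 L) ≠ Pi.single 0 1 + Pi.single 1 1 := by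
  intro h
  have := congrFun h 0
  simp only [Pi.neg_apply, Pi.add_apply, Pi.single_eq_same, Pi.single_eq_of_ne (by decide : (0 : Fin 2) ≠ 1), add_zero] at this
  exact one_ne_neg_one_zmod hL this.symm

omit [NeZero L] in
/-- `-(e₀ - e₁) ≠ e₀ - e₁` in `(ℤ/L)²` for `L ≥ 3`. [folklore] -/
theorem neg_antidiag_ne_antidiag (hL : 3 ≤ L) :
    -(Pi.single 0 1 - Pi.single 1 1 : TorusSite 2 L) ≠ Pi.single 0 1 - Pi.single 1 1 := by
  intro h
  have := congrFun h 0
  simp only [Pi.neg_apply, Pi.sub_apply, Pi.single_eq_same, Pi.single_eq_of_ne (by decide : (0 : Fin 2) ≠ 1), sub_zero] at this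
  exact one_ne_neg_one_zmod hL this.symm

/-- The `e₀`-pair and the `e₁`-pair conditions are exclusive (`L ≥ 2`). [folklore] -/
theorem not_pair0_and_pair1 (hL : 2 ≤ L) (r : TorusSite 2 L) :
    ¬((r = -(Pi.single 0 1) ∨ r = Pi.single 0 1) ∧ (r = -(Pi.single 1 1) ∨ r = Pi.single 1 1)) := by
  rintro ⟨h0, h1⟩
  have h1' : r 0 = 0 := by
    rcases h1 with h | h <;> simp [h]
  have h0' : r 0 = -1 ∨ r 0 = 1 := by
    rcases h0 with h | h <;> simp [h]
  rw [h1'] at h0'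
  rcases h0' with h | h
  · exact one_ne_zero_zmod hL (neg_eq_zero.1 h.symm)
  · exact one_ne_zero_zmod hL h.symm

omit [NeZero L] in
/-- The diagonal-pair and antidiagonal-pair conditions are exclusive (`L ≥ 3`). [folklore] -/
theorem not_diag_and_antidiag (hL : 3 ≤ L) (r : TorusSite 2 L) :
    ¬((r = -(Pi.single 0 1 + Pi.single 1 1) ∨ r = Pi.single 0 1 + Pi.single 1 1) ∧
      (r = -(Pi.single 0 1 - Pi.single 1 1) ∨ r = Pi.single 0 1 - Pi.single 1 1)) := by
  have h01 : (0 : Fin 2) ≠ 1 := by decide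
  rintro ⟨hd, ha⟩
  -- compare the two coordinates: on the diagonal pair `r 0 = r 1`, on the antidiagonal `r 0 = -r 1`
  have hd' : r 0 = r 1 := by
    rcases hd with h | h <;> simp [h, h01, h01.symm]
  have ha' : r 0 = -r 1 ∧ (r 1 = 1 ∨ r 1 = -1) := by
    rcases ha with h | h <;> simp [h, h01, h01.symm]
  obtain ⟨ha1, ha2⟩ := ha'
  rw [hd'] at ha1
  rcases ha2 with h | h
  · rw [h] at ha1; exact one_ne_neg_one_zmod hL ha1
  · rw [h, neg_neg] at ha1; exact one_ne_neg_one_zmod hL ha1.symm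

/-! ### The symbols -/

/-- **Symbol of the hopping stencil** (`L ≥ 3`): `FTa(k) = ξ_k = -2cos p₀ - 2cos p₁ - μ`,
`p = 2πk/L` — the band function of the nearest-neighbour torus (Friedli–Velenik 2017, §10.4,
symbol of the lattice Laplacian). [cite: FriedliVelenik2017, §10.4] -/
theorem torusFourier_hopVec (hL : 3 ≤ L) (μ : ℝ) (k : TorusSite 2 L) :
    torusFourier (fun r : TorusSite 2 L =>
        -(if ((r = -![1, 0] ∨ r = -![-1, 0]) ∨ (r = -![0, 1] ∨ r = -![0, -1]))
            then (1 : ℂ) else 0) - (if r = 0 then (μ : ℂ) else 0)) k =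
      ((-2 * Real.cos (latticeMomentum L k 0) - 2 * Real.cos (latticeMomentum L k 1) - μ : ℝ) : ℂ) := by
  have hL2 : 2 ≤ L := le_trans (by norm_num) hL
  rw [torusFourier_eq_sum_torusChar]
  simp only [vec_neg10, vec_neg01, neg_neg, vec10_eq_single, vec01_eq_single]
  have hsplit : ∀ r : TorusSite 2 L,
      (if ((r = -Pi.single 0 1 ∨ r = Pi.single 0 1) ∨ (r = -Pi.single 1 1 ∨ r = Pi.single 1 1))
          then (1 : ℂ) else 0) =
        (if (r = -Pi.single 0 1 ∨ r = Pi.single 0 1) then (1 : ℂ) else 0) +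
          (if (r = -Pi.single 1 1 ∨ r = Pi.single 1 1) then (1 : ℂ) else 0) :=
    fun r => ite_or_eq_add (not_pair0_and_pair1 hL2 r)
  simp_rw [hsplit]
  have hsum : ∀ r : TorusSite 2 L,
      (-((if (r = -Pi.single 0 1 ∨ r = Pi.single 0 1) then (1 : ℂ) else 0) +
          (if (r = -Pi.single 1 1 ∨ r = Pi.single 1 1) then (1 : ℂ) else 0)) -
          (if r = 0 then (μ : ℂ) else 0)) * conj (torusChar k r) =
        -((if (r = -Pi.single 0 1 ∨ r = Pi.single 0 1) then (1 : ℂ) else 0) * conj (torusChar k r)) -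
          (if (r = -Pi.single 1 1 ∨ r = Pi.single 1 1) then (1 : ℂ) else 0) * conj (torusChar k r) -
          (if r = 0 then (μ : ℂ) * conj (torusChar k r) else 0) := by
    intro r
    split_ifs <;> ring
  simp_rw [hsum, Finset.sum_sub_distrib, Finset.sum_neg_distrib, Finset.sum_ite_eq',
    Finset.mem_univ, if_true, sum_pair_conj_torusChar k _ (neg_single_ne_single hL _),
    torusChar_single_add_conj', torusChar_zero_right, map_one, mul_one]
  push_cast
  ring

/-- **Symbol of the `d+id` pairing stencil** (`L ≥ 3`):
`FTd(k) = Δ_k = 2Δ₁(cos p₀ - cos p₁) - 4iΔ₂ sin p₀ sin p₁` (the crux docstring's gap function;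
`cos(p₀+p₁) - cos(p₀-p₁) = -2 sin p₀ sin p₁`). [folklore] -/
theorem torusFourier_pairVec (hL : 3 ≤ L) (Δ₁ Δ₂ : ℝ) (k : TorusSite 2 L) :
    torusFourier (fun r : TorusSite 2 L =>
        (Δ₁ : ℂ) * ((if (r = -![1, 0] ∨ r = -![-1, 0]) then (1 : ℂ) else 0) -
            (if (r = -![0, 1] ∨ r = -![0, -1]) then (1 : ℂ) else 0)) +
          Complex.I * (Δ₂ : ℂ) * ((if (r = -![1, 1] ∨ r = -![-1, -1]) then (1 : ℂ) else 0) -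
            (if (r = -![1, -1] ∨ r = -![-1, 1]) then (1 : ℂ) else 0))) k =
      ((2 * Δ₁ * (Real.cos (latticeMomentum L k 0) - Real.cos (latticeMomentum L k 1)) : ℝ) : ℂ) -
        4 * Complex.I * ((Δ₂ * Real.sin (latticeMomentum L k 0) * Real.sin (latticeMomentum L k 1) : ℝ) : ℂ) := by
  rw [torusFourier_eq_sum_torusChar]
  simp only [vec_neg10, vec_neg01, vec_neg11, vec_neg1m1, neg_neg, vec10_eq_single,
    vec01_eq_single, vec11_eq, vec1m1_eq]
  have hsum : ∀ r : TorusSite 2 L,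
      ((Δ₁ : ℂ) * ((if (r = -Pi.single 0 1 ∨ r = Pi.single 0 1) then (1 : ℂ) else 0) -
            (if (r = -Pi.single 1 1 ∨ r = Pi.single 1 1) then (1 : ℂ) else 0)) +
          Complex.I * (Δ₂ : ℂ) *
            ((if (r = -(Pi.single 0 1 + Pi.single 1 1) ∨ r = Pi.single 0 1 + Pi.single 1 1)
                then (1 : ℂ) else 0) -
              (if (r = -(Pi.single 0 1 - Pi.single 1 1) ∨ r = Pi.single 0 1 - Pi.single 1 1)
                then (1 : ℂ) else 0))) * conj (torusChar k r) =
        (Δ₁ : ℂ) * ((if (r = -Pi.single 0 1 ∨ r = Pi.single 0 1) then (1 : ℂ) else 0) *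
              conj (torusChar k r)) -
          (Δ₁ : ℂ) * ((if (r = -Pi.single 1 1 ∨ r = Pi.single 1 1) then (1 : ℂ) else 0) *
              conj (torusChar k r)) +
          Complex.I * (Δ₂ : ℂ) *
            ((if (r = -(Pi.single 0 1 + Pi.single 1 1) ∨ r = Pi.single 0 1 + Pi.single 1 1)
                then (1 : ℂ) else 0) * conj (torusChar k r)) -
          Complex.I * (Δ₂ : ℂ) *
            ((if (r = -(Pi.single 0 1 - Pi.single 1 1) ∨ r = Pi.single 0 1 - Pi.single 1 1)
                then (1 : ℂ) else 0) * conj (torusChar k r)) := by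
    intro r; ring
  simp_rw [hsum, Finset.sum_sub_distrib, Finset.sum_add_distrib, Finset.sum_sub_distrib,
    ← Finset.mul_sum, sum_pair_conj_torusChar k _ (neg_single_ne_single hL _),
    sum_pair_conj_torusChar k _ (neg_diag_ne_diag hL),
    sum_pair_conj_torusChar k _ (neg_antidiag_ne_antidiag hL), torusChar_single_add_conj',
    torusChar_diag_add_conj, torusChar_antidiag_add_conj, Real.cos_add, Real.cos_sub]
  push_cast
  ring

/-! ### The full gap -/

/-- **The `d+id` reference is fully gapped**: for `μ ∈ (-4,4)`, `Δ₁ ≠ 0`, `Δ₂ ≠ 0` and all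
momenta, `ξ² + |Δ|² > 0` with `ξ = -2cos p₀ - 2cos p₁ - μ`,
`Δ = 2Δ₁(cos p₀ - cos p₁) - 4iΔ₂ sin p₀ sin p₁` (the gap function vanishes only where
`sin p₀ sin p₁ = 0` and `cos p₀ = cos p₁ = ±1`, and there `ξ = ∓4 - μ ≠ 0`). [folklore] -/
theorem bdg_dispersion_pos (μ Δ₁ Δ₂ p₀ p₁ : ℝ) (hμ : μ ∈ Set.Ioo (-4 : ℝ) 4) (h₁ : Δ₁ ≠ 0)
    (h₂ : Δ₂ ≠ 0) :
    0 < (-2 * Real.cos p₀ - 2 * Real.cos p₁ - μ) ^ 2 +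
      ‖((2 * Δ₁ * (Real.cos p₀ - Real.cos p₁) : ℝ) : ℂ) -
          4 * Complex.I * ((Δ₂ * Real.sin p₀ * Real.sin p₁ : ℝ) : ℂ)‖ ^ 2 := by
  by_contra hle
  push Not at hle
  have hsq1 : 0 ≤ (-2 * Real.cos p₀ - 2 * Real.cos p₁ - μ) ^ 2 := sq_nonneg _
  have hsq2 : 0 ≤ ‖((2 * Δ₁ * (Real.cos p₀ - Real.cos p₁) : ℝ) : ℂ) -
      4 * Complex.I * ((Δ₂ * Real.sin p₀ * Real.sin p₁ : ℝ) : ℂ)‖ ^ 2 := sq_nonneg _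
  have hξ : (-2 * Real.cos p₀ - 2 * Real.cos p₁ - μ) ^ 2 = 0 := by linarith
  have hΔ : ‖((2 * Δ₁ * (Real.cos p₀ - Real.cos p₁) : ℝ) : ℂ) -
      4 * Complex.I * ((Δ₂ * Real.sin p₀ * Real.sin p₁ : ℝ) : ℂ)‖ ^ 2 = 0 := by linarith
  rw [sq_eq_zero_iff, norm_eq_zero] at hΔ
  have hre := congrArg Complex.re hΔ
  have him := congrArg Complex.im hΔ
  simp only [Complex.sub_re, Complex.ofReal_re, Complex.mul_re, Complex.re_ofNat,
    Complex.I_re, Complex.im_ofNat, Complex.I_im, Complex.ofReal_im, Complex.zero_re,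
    Complex.sub_im, Complex.mul_im, Complex.zero_im] at hre him
  -- `hre : 2Δ₁(cos p₀ - cos p₁) = 0`, `him : 4Δ₂ sin p₀ sin p₁ = 0`
  have hcos : Real.cos p₀ = Real.cos p₁ := by
    have : 2 * Δ₁ * (Real.cos p₀ - Real.cos p₁) = 0 := by linarith
    rcases mul_eq_zero.1 this with h | h
    · exact absurd (by linarith : Δ₁ = 0) h₁
    · linarith
  have hsin : Real.sin p₀ * Real.sin p₁ = 0 := by
    have : 4 * (Δ₂ * Real.sin p₀ * Real.sin p₁) = 0 := by linarith
    have : Δ₂ * (Real.sin p₀ * Real.sin p₁) = 0 := by linarith [this]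
    rcases mul_eq_zero.1 this with h | h
    · exact absurd h h₂
    · exact h
  have hξ0 : -2 * Real.cos p₀ - 2 * Real.cos p₁ - μ = 0 := by
    rwa [sq_eq_zero_iff] at hξ
  -- one of the sines vanishes, so the common cosine is `±1`
  have hc2 : Real.cos p₀ ^ 2 = 1 := by
    rcases mul_eq_zero.1 hsin with h | h
    · have := Real.sin_sq_add_cos_sq p₀
      rw [h] at this
      linarith
    · have := Real.sin_sq_add_cos_sq p₁
      rw [h, ← hcos] at this
      linarith
  have hc : Real.cos p₀ = 1 ∨ Real.cos p₀ = -1 := by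
    have hprod : (Real.cos p₀ - 1) * (Real.cos p₀ + 1) = 0 := by nlinarith [hc2]
    rcases mul_eq_zero.1 hprod with h | h
    · left; linarith
    · right; linarith
  rcases hc with h | h
  · rw [← hcos, h] at hξ0
    have : μ = -4 := by linarith
    exact absurd this (ne_of_gt hμ.1)
  · rw [← hcos, h] at hξ0
    have : μ = 4 := by linarith
    exact absurd this (ne_of_lt hμ.2)

end BirBdG

end Summit.HubbardSuperconductivity.HubbardSuperconductivity.Theorems

end
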